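import Literature.IUT.LogThetaLattice.BiCoresOfKits
import Literature.IUT.LogThetaLattice.ThetaMonoidsOfKits
import Literature.IUT.LogThetaLattice.ThetaLinkOfKits
import Literature.IUT.LogThetaLattice.LatticeGlue

/-!
# `LatticeGlue.ofKits`: the glued [IUTchIII] §1–§2 data — the input of `Thm311.LinkData.ofGlue` — over the frame ASSEMBLED from the kits

Mochizuki, *Inter-universal Teichmüller Theory III*, kurims manuscript (May 2020), §1–§2: Def 1.1 p. 23, Prop 1.2 (vi)–(ix)
pp. 32–34, Def 1.4 pp. 45–46, Thm 1.5 (i)–(v) pp. 48–51, Prop 2.1 (i)–(vi) pp. 58–61, Thm 2.2 (i) p. 65, Cor 2.3 (i)–(iv)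
pp. 72–75; *II* (Dec 2020), Def 4.9 (vi)–(viii) pp. 157–158, Cor 4.5 (ii) p. 132, Cor 4.10 (i)–(iv) pp. 158–160; *I*
(May 2020) Def 4.1 (iv) p. 96. ([IUTchIII] Cor 2.3 (i) p.72) [claim: Mochizuki2012, status: disputed]. MERGE-MAP
plan/L6/MERGE-MAP.md v16 CC1 («§1–2/C312 constructions specialise to the kit frame» — BLOCKED on the C312 side by the
universe patch R-a; this file removes the L6-side half of the blockage). Consumer seat abc-iut-L6-t3 (gen 4). Nothing of the
series is asserted; typed ≠ discharged.

`Literature.IUT.LogThetaLattice.LatticeGlue S` (`LatticeGlue.lean`, this seat, gen 2) bundles the five [IUTchIII] §1–§2 interfaces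
over a strip frame `S` — `LogStripData` (Def 1.1), `ThetaLinkData` (Cor 4.10 / Def 1.4), `BiCoricData` (Prop 1.2 (vi)–(ix),
Thm 1.5 (iii)–(v)), `ThetaMonoidData` (Prop 2.1, Thm 2.2), `ThetaCoricData` (Cor 2.3) — with the identifications between their
overlapping copies of the same printed functor; it is THE input of the Cor 3.12 crew's
`Summit.ABC.IUTFork.Thm311.LinkData.ofGlue (G : LatticeGlue S) (Λ : LogThetaLatticeDiagram G.logData G.linkData)`.
The four preceding `…OfKits` files instantiate the five interfaces over the REAL frame `StripFrame.ofKits L hbij hsurj hR X`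
from kit-level data (`LogKit` — `LogStripOfKits`; `ThetaLinkKit` — `ThetaLinkOfKits`; `BiCoricKit` — `BiCoresOfKits`;
`ThetaMonoidKit` — `ThetaMonoidsOfKits`; and here `ThetaCoricKit`). This file:

* `ThetaCoricKit X` ↦ `ThetaCoricData.ofKits` (Cor 2.3's inputs; its connectedness field `iso_nonempty_Dv` — [IUTchI]
  Def 4.1 (iii)/(iv) "any two `𝒟^⊢`-prime-strips are isomorphic" — is a kit-level HYPOTHESIS: abc-iut-L5-t4's abstract
  groupoid `M.DMono` has no such field);
* `LatticeGlueKit hR X` = the five kits + the eight printed identifications at kit level ↦ **`LatticeGlue.ofKits`** over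
  `StripFrame.ofKits L hbij hsurj hR X` (under abc-iut-w4-d028's one hypothesis `h` on the Def 4.9 input `X`, needed by
  `ThetaMonoidData.ofKits` for [IUTchIII] Thm 2.2 (i)), and **`LatticeGlue.ofPassages`** over `TimesMuSide.ofPassages`
  (`TimesMuSideOfStrips`) with NO [IUTchII]-side hypothesis; the coherence EQUATION `fxmOfDv_dv_compat` PROVED from its
  kit-level form.
Consequently `Thm311.LinkData.ofGlue (LatticeGlue.ofKits …) (LogThetaLatticeDiagram.ofKits …)` is well-typed as soon as the
C312 files take a universe-polymorphic frame (R-a); until then the specialisation is blocked on their side only.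
INPUT BY NAME throughout (the kits' ambient categories are abstract); `hbij`/`hsurj`/`hR` ([IUTchI] Cor 5.3 (ii)(iii),
Rmk 5.2.1 (ii)) remain abc-iut-L5-t4's named kit hypotheses.
-/

namespace Literature.IUT.LogThetaLattice

open CategoryTheory
open Literature.IUT.HodgeTheaters Literature.IUT.HodgeTheaters.PMBaseKit
open Literature.IUT.HodgeArakelov
open AsSmallTransport

universe u v w

section Kit

variable {l : ℕ} {K : PMBaseKit.{u} l} {M : K.MultKit} {FK : K.FKit M} {L : FK.MonoLaws}

/-! ### 1. Cor 2.3's inputs at kit level -/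

/-- **IUTchIII:Cor2.3** (kurims p.72) KIT-LEVEL INPUT for `ThetaCoricData` (the functorial algorithms Cor 2.3 quotes: `†ℋ𝒯^𝒟 ↦ †𝔇^⊢_△`
[Thm 1.5 (iii); IUTchII Cor 4.10 (i)], `†𝔇^⊢ ↦ F^{⊢×μ}(†𝔇^⊢)` with `D^⊢(F^{⊢×μ}(†𝔇^⊢)) = †𝔇^⊢` [IUTchII Cor 4.5 (ii); Def 4.9 (vi)(vii)],
`†ℋ𝒯^𝒟 ↦ F^⊩_{env}(†𝔇_>)` [Prop 2.1 (ii)], the bad-prime data `†ℜ^{bad}` [Thm 2.2 (ii)]) over abc-iut-L5-t4's kits, the Def 4.9 input's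
`X.Fxm` and this seat's `DHTRep K`; plus the CONNECTEDNESS of `𝒟^⊢`-prime-strips ([IUTchI] Def 4.1 (iii) p.96 "admits an
equivalence `†𝒟^⊢_v ⥲ 𝒟^⊢_v`" — every `𝒟^⊢`-prime-strip is an isomorph of the model) as a HYPOTHESIS on the kit's abstract groupoid
`M.DMono`, which carries no such field. Each field quotes the `ThetaCoricData` field it instantiates. INPUT BY NAME (owners
abc-iut-L6-t1/t2; TODO-merge). ([IUTchIII] Cor 2.3 p.72) [claim: Mochizuki2012, status: disputed] -/
structure ThetaCoricKit (X : TimesMuSide FK L) : Type (u + 1) where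
  /-- `ThetaCoricData.dvDelta`: `†ℋ𝒯^𝒟 ↦ †𝔇^⊢_△` -/
  dvDelta : DHTRep K ⥤ M.DMono
  /-- `ThetaCoricData.fxmOfDv`: `†𝔇^⊢ ↦ F^{⊢×μ}(†𝔇^⊢)` -/
  fxmOfDv : M.DMono ⥤ X.Fxm
  /-- `ThetaCoricData.fxmOfDv_dv`: the `𝒟^⊢`-prime-strip of `F^{⊢×μ}(†𝔇^⊢)` is `†𝔇^⊢` -/
  fxmOfDv_dv : fxmOfDv ⋙ X.FxmToDv ≅ 𝟭 _
  /-- `ThetaCoricData.fglEnv`: `†ℋ𝒯^𝒟 ↦ F^⊩_{env}(†𝔇_>)` into the kit's `ℱ^⊩`-prime-strips -/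
  fglEnv : DHTRep K ⥤ FK.FrStrip
  /-- `ThetaCoricData.Rbad`: the category of bad-prime data `†ℜ^{bad}` [Thm 2.2 (ii) (a_v)–(d_v)] -/
  Rbad : Type u
  [catRbad : Category.{u} Rbad]
  /-- `ThetaCoricData.rbad`: `†ℋ𝒯^𝒟 ↦ †ℜ^{bad}` -/
  rbad : DHTRep K ⥤ Rbad
  /-- `ThetaCoricData.iso_nonempty_Dv`: any two `𝒟^⊢`-prime-strips of the kit are isomorphic [IUTchI, Def 4.1 (iii)(iv)] — HYPOTHESIS -/
  iso_nonempty_Dv : ∀ A B : M.DMono, Nonempty (A ≅ B)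

attribute [instance] ThetaCoricKit.catRbad

variable (L) (hbij : FK.IsomFtoDBijective) (hsurj : FK.IsomFmtoDmSurjective) (hR : FK.RlfOfIsStrip)
  (X : TimesMuSide FK L)

/-- **IUTchIII:Cor2.3** (kurims p.72) **`ThetaCoricData.ofKits`** — this seat's Cor 2.3 input interface INSTANTIATED over the real frame
`StripFrame.ofKits L hbij hsurj hR X` from `Ck : ThetaCoricKit X` (AsSmall transport; connectedness of the small models of
`𝒟^⊢`-prime-strips from the kit-level hypothesis). ([IUTchIII] Cor 2.3 p.72) [claim: Mochizuki2012, status: disputed] -/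
noncomputable def ThetaCoricData.ofKits (Ck : ThetaCoricKit X) : ThetaCoricData (StripFrame.ofKits L hbij hsurj hR X) where
  dvDelta := liftF Ck.dvDelta
  fxmOfDv := liftF Ck.fxmOfDv
  fxmOfDv_dv := liftUnit Ck.fxmOfDv_dv
  fglEnv := liftF Ck.fglEnv
  Rbad := AsSmall.{max 1 u} Ck.Rbad
  rbad := liftF Ck.rbad
  iso_nonempty_Dv := iso_nonempty_lift Ck.iso_nonempty_Dv

/-! ### 2. The glued data at kit level and `LatticeGlue.ofKits` -/

variable {L} in
/-- **IUTchIII:Cor2.3(i)** (kurims p.72) KIT-LEVEL INPUT for `LatticeGlue`: the five kit-level data (`LogKit` Def 1.1; `ThetaLinkKit`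
[IUTchII] Cor 4.10 / Def 1.4; `BiCoricKit` Prop 1.2 (vi)–(ix) / Thm 1.5 (iii)–(v); `ThetaMonoidKit` Prop 2.1 / Thm 2.2; `ThetaCoricKit`
Cor 2.3) together with the eight IDENTIFICATIONS of `LatticeGlue` at kit level — each field quotes the `LatticeGlue` field it
instantiates (print treats the identified functors as ONE object; the frame types the copies separately):
`fglRoute_iso` [IUTchII Def 4.9 (vi)–(viii): the `F^{⊢×μ}`-prime-strip of the `F^{⊩▶×μ}`-prime-strip of `*𝔉^⊩` is that of its
`ℱ^⊢`-prime-strip — relative to the Rmk 5.2.1 (ii) hypothesis `hR` through which the frame's `F^⊩ ↦ F^⊢` is built],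
`fxmDeltaHT_iso` [Thm 1.5 (ii) / Cor 4.10 (iv)], `dvDelta_iso` [Thm 1.5 (iii) / Cor 4.10 (i)], `fxmOfDv_iso` + `fxmOfDv_dv_compat`
[Cor 4.5 (ii)], `fxmDeltaD_iso` [Thm 1.5 (iii) / Prop 2.1 (vi)], `fglEnv_iso` [Prop 2.1 (ii)], `pilotEnv_iso` [Cor 4.10 (ii) / Def 4.9
(viii)]. INPUT BY NAME. ([IUTchIII] Cor 2.3 (i) p.72) [claim: Mochizuki2012, status: disputed] -/
structure LatticeGlueKit (hR : FK.RlfOfIsStrip) (X : TimesMuSide FK L) : Type (u + 1) where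
  /-- Def 1.1: the per-place log-Frobenius datum (`LogStripOfKits`) -/
  logKit : LogKit FK
  /-- [IUTchII] Cor 4.10: the pilot strips (`ThetaLinkOfKits`) -/
  linkKit : ThetaLinkKit X
  /-- Prop 1.2 (vi)–(ix), Thm 1.5 (iii)–(v): log-shell / bi-core data (`BiCoresOfKits`) -/
  biCoricKit : BiCoricKit X
  /-- Prop 2.1, Thm 2.2: theta-monoid data (`ThetaMonoidsOfKits`) -/
  thetaMonoidKit : ThetaMonoidKit X
  /-- Cor 2.3: the radial/coric inputs -/
  coricKit : ThetaCoricKit X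
  /-- `LatticeGlue.fglRoute_iso`: `F^⊩ → F^{⊩▶×μ} → F^{⊢▶×μ} → F^{⊢×μ}` ≅ `F^⊩ → F^⊢ → F^{⊢×μ}` (the frame's `F^⊩ ↦ F^⊢` = abc-iut-L6-t7's
  `rlfFmFunctor` under `hR`) -/
  fglRoute_iso : X.FglToFglxm ⋙ X.FglxmToFvtxm ⋙ X.FvtxmToFxm ≅
    PrimeStripGroupoids.rlfFmFunctor FK (FKit.nonempty_rlfFm_rlfModel_iso_of_rlfOfIsStrip hR) ⋙ X.FvToFxm
  /-- `LatticeGlue.fxmDeltaHT_iso`: `BiCores`' copy of `†ℋ𝒯 ↦ †𝔉^{⊢×μ}_△` is the link data's `pilotDelta ⋙ (F^{⊩▶×μ} ↦ F^{⊢×μ})` -/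
  fxmDeltaHT_iso : biCoricKit.fxmDeltaHT ≅ linkKit.pilotDelta ⋙ X.FglxmToFvtxm ⋙ X.FvtxmToFxm
  /-- `LatticeGlue.dvDelta_iso`: `RadialData`'s copy of `†ℋ𝒯^𝒟 ↦ †𝔇^⊢_△` is `BiCores`' -/
  dvDelta_iso : coricKit.dvDelta ≅ biCoricKit.dvDelta
  /-- `LatticeGlue.fxmOfDv_iso`: `RadialData`'s copy of `†𝔇^⊢ ↦ F^{⊢×μ}(†𝔇^⊢)` is `BiCores`' -/
  fxmOfDv_iso : coricKit.fxmOfDv ≅ biCoricKit.fxmOfDv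
  /-- `LatticeGlue.fxmOfDv_dv_compat`: the two identifications `D^⊢(F^{⊢×μ}(†𝔇^⊢)) = †𝔇^⊢` correspond under `fxmOfDv_iso` -/
  fxmOfDv_dv_compat :
    Functor.isoWhiskerRight fxmOfDv_iso X.FxmToDv ≪≫ biCoricKit.fxmOfDv_dv = coricKit.fxmOfDv_dv
  /-- `LatticeGlue.fxmDeltaD_iso`: `ThetaMonoids`' copy of `†ℋ𝒯^𝒟 ↦ F^{⊢×μ}_△(†𝔇^⊢_△)` is `BiCores`' -/
  fxmDeltaD_iso : thetaMonoidKit.fxmDeltaD ≅ biCoricKit.dvDelta ⋙ biCoricKit.fxmOfDv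
  /-- `LatticeGlue.fglEnv_iso`: `RadialData`'s copy of `†ℋ𝒯^𝒟 ↦ F^⊩_{env}(†𝔇_>)` is `ThetaMonoids`' (through `†𝔇_>` = `≻`) -/
  fglEnv_iso : coricKit.fglEnv ≅ DHTRep.codFunctor ⋙ thetaMonoidKit.FglEnvD
  /-- `LatticeGlue.pilotEnv_iso`: the non-Gaussian pilot `†𝔉^{⊩▶×μ}_{env}` is the `F^{⊩▶×μ}`-prime-strip of `ThetaMonoids`' `†𝔉^⊩_{env}` -/
  pilotEnv_iso : linkKit.pilotTheta LatticeKind.nonGaussian ≅ thetaMonoidKit.FglEnvHT ⋙ X.FglToFglxm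

variable {L hR X} in
/-- **IUTchII:Cor4.5(ii)** (kurims p.132) TRANSPORT of the coherence equation: the two identifications `D^⊢(F^{⊢×μ}(†𝔇^⊢)) = †𝔇^⊢` of the
small models correspond under the transported `fxmOfDv_iso` (componentwise the kit-level equation, re-wrapped).
([IUTchII] Cor 4.5 (ii) p.132) [claim: Mochizuki2012, status: disputed] -/
theorem LatticeGlueKit.fxmOfDv_dv_compat_lift (Gk : LatticeGlueKit hR X) :
    Functor.isoWhiskerRight (liftNatIso.{max 1 u} Gk.fxmOfDv_iso) (liftF X.FxmToDv) ≪≫ liftUnit Gk.biCoricKit.fxmOfDv_dv =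
      liftUnit.{max 1 u} Gk.coricKit.fxmOfDv_dv := by
  ext D
  have h := congrArg (fun e : Gk.coricKit.fxmOfDv ⋙ X.FxmToDv ≅ 𝟭 _ => e.hom.app (ULift.down D)) Gk.fxmOfDv_dv_compat
  exact ULift.ext _ _ h

/-- **IUTchIII:Cor2.3(i)** (kurims p.72) **`LatticeGlue.ofKits`** — the glued [IUTchIII] §1–§2 data over the REAL frame `StripFrame.ofKits L hbij hsurj hR X`,
assembled from kit-level data `Gk : LatticeGlueKit hR X`: `logData := LogStripData.ofKits`, `linkData := ThetaLinkData.ofKits`,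
`biCoric := BiCoricData.ofKits`, `thetaMonoid := ThetaMonoidData.ofKits` (under abc-iut-w4-d028's one hypothesis `h` on the Def 4.9
input, for [IUTchIII] Thm 2.2 (i)), `coric := ThetaCoricData.ofKits`, the eight identifications transported along `AsSmall` and the
coherence equation PROVED (`fxmOfDv_dv_compat_lift`). This is the input type of the Cor 3.12 crew's `Thm311.LinkData.ofGlue` at the
real frame. ([IUTchIII] Cor 2.3 (i) p.72) [claim: Mochizuki2012, status: disputed] -/
noncomputable def LatticeGlue.ofKits
    (h : ∀ A B : X.Fglxm, Function.Surjective (fun g : A ≅ B => (X.FglxmToFvtxm ⋙ X.FvtxmToFxm).mapIso g))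
    (Gk : LatticeGlueKit hR X) : LatticeGlue (StripFrame.ofKits L hbij hsurj hR X) where
  logData := LogStripData.ofKits L hbij hsurj hR X Gk.logKit
  linkData := ThetaLinkData.ofKits L hbij hsurj hR X Gk.linkKit
  biCoric := BiCoricData.ofKits L hbij hsurj hR X Gk.biCoricKit
  thetaMonoid := ThetaMonoidData.ofKits L hbij hsurj hR X h Gk.thetaMonoidKit
  coric := ThetaCoricData.ofKits L hbij hsurj hR X Gk.coricKit
  fglRoute_iso := NatIso.ofComponents (fun F => AsSmall.up.mapIso (Gk.fglRoute_iso.app (ULift.down F)))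
    (fun f => ULift.ext _ _ (Gk.fglRoute_iso.hom.naturality f.down))
  fxmDeltaHT_iso := NatIso.ofComponents (fun H => AsSmall.up.mapIso (Gk.fxmDeltaHT_iso.app (ULift.down H)))
    (fun f => ULift.ext _ _ (Gk.fxmDeltaHT_iso.hom.naturality f.down))
  dvDelta_iso := liftNatIso Gk.dvDelta_iso
  fxmOfDv_iso := liftNatIso Gk.fxmOfDv_iso
  fxmOfDv_dv_compat := Gk.fxmOfDv_dv_compat_lift
  fxmDeltaD_iso := NatIso.ofComponents (fun H => AsSmall.up.mapIso (Gk.fxmDeltaD_iso.app (ULift.down H)))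
    (fun f => ULift.ext _ _ (Gk.fxmDeltaD_iso.hom.naturality f.down))
  fglEnv_iso := NatIso.ofComponents (fun H => AsSmall.up.mapIso (Gk.fglEnv_iso.app (ULift.down H)))
    (fun f => ULift.ext _ _ (Gk.fglEnv_iso.hom.naturality f.down))
  pilotEnv_iso := NatIso.ofComponents (fun H => AsSmall.up.mapIso (Gk.pilotEnv_iso.app (ULift.down H)))
    (fun f => ULift.ext _ _ (Gk.pilotEnv_iso.hom.naturality f.down))

/-- **IUTchIII:Def1.4** (kurims p.45) … and then ANY injective family of `Θ^{±ell}`-Hodge theaters over the kits indexed by `ℤ × ℤ` is a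
log-theta-lattice over the glued data's log-data and link-data (`LogThetaLatticeDiagram.ofKits`, `ThetaLinkOfKits`) — so the pair
(`LatticeGlue.ofKits …`, `LogThetaLatticeDiagram.ofKits …`) is an instance of the INPUT SHAPE of `Thm311.LinkData.ofGlue`.
([IUTchIII] Def 1.4 p.45) [claim: Mochizuki2012, status: disputed] -/
noncomputable def LatticeGlue.ofKitsDiagram
    (h : ∀ A B : X.Fglxm, Function.Surjective (fun g : A ≅ B => (X.FglxmToFvtxm ⋙ X.FvtxmToFxm).mapIso g))
    (Gk : LatticeGlueKit hR X) (kind : LatticeKind) (H : ℤ × ℤ → FK.ThetaPMEllHT) (hH : Function.Injective H) :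
    LogThetaLatticeDiagram (LatticeGlue.ofKits L hbij hsurj hR X h Gk).logData
      (LatticeGlue.ofKits L hbij hsurj hR X h Gk).linkData :=
  LogThetaLatticeDiagram.ofKits L hbij hsurj hR X Gk.linkKit Gk.logKit kind H hH

/-- **IUTchIII:Cor2.3(i)** (kurims p.72) Hence `LatticeGlue` over the real frame is INHABITED as soon as the kit-level glued data are
given, under the one hypothesis `h` on the Def 4.9 input. ([IUTchIII] Cor 2.3 (i) p.72) [claim: Mochizuki2012, status: disputed] -/
theorem nonempty_latticeGlue_ofKits
    (h : ∀ A B : X.Fglxm, Function.Surjective (fun g : A ≅ B => (X.FglxmToFvtxm ⋙ X.FvtxmToFxm).mapIso g))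
    (hG : Nonempty (LatticeGlueKit hR X)) : Nonempty (LatticeGlue (StripFrame.ofKits L hbij hsurj hR X)) :=
  ⟨LatticeGlue.ofKits L hbij hsurj hR X h hG.some⟩

end Kit

/-! ### 3. Over `TimesMuSide.ofPassages`: no [IUTchII]-side hypothesis -/

section OfPassages

variable {l : ℕ} {K : PMBaseKit.{max (v + 1) w} l} {M : K.MultKit} {FK : K.FKit M}
  {P : PlaceData K.V} {G : K.V → Type} [∀ v, Group (G v)]
  {X : ∀ v, GroupTheoreticUnits.{0, w} (G v)} {S₀ : FVdashSplitTriMuPrimeStrip.{0, v, w} P G X}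
  (L : FK.MonoLaws) (hbij : FK.IsomFtoDBijective) (hsurj : FK.IsomFmtoDmSurjective) (hR : FK.RlfOfIsStrip)
  (Ps : TimesMuPassages FK S₀)

/-- **IUTchIII:Cor2.3(i)** (kurims p.72) **`LatticeGlue.ofPassages`** — the glued [IUTchIII] §1–§2 data over the real frame built on
abc-iut-L6-t2's print-level strip groupoids (`TimesMuSide.ofPassages L hR Ps`), from kit-level glued data, with NO hypothesis on
the [IUTchII] side ([IUTchIII] Thm 2.2 (i) = `TimesMuSide.ofPassages_mapIso_surjective`). ([IUTchIII] Cor 2.3 (i) p.72)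
[claim: Mochizuki2012, status: disputed] -/
noncomputable def LatticeGlue.ofPassages (Gk : LatticeGlueKit hR (TimesMuSide.ofPassages L hR Ps)) :
    LatticeGlue (StripFrame.ofKits L hbij hsurj hR (TimesMuSide.ofPassages L hR Ps)) :=
  LatticeGlue.ofKits L hbij hsurj hR _ (TimesMuSide.ofPassages_mapIso_surjective L hR Ps) Gk

/-- **IUTchIII:Cor2.3(i)** (kurims p.72) … so over the print-level groupoids `LatticeGlue` is INHABITED as soon as kit-level glued data are
given. ([IUTchIII] Cor 2.3 (i) p.72) [claim: Mochizuki2012, status: disputed] -/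
theorem nonempty_latticeGlue_ofPassages (hG : Nonempty (LatticeGlueKit hR (TimesMuSide.ofPassages L hR Ps))) :
    Nonempty (LatticeGlue (StripFrame.ofKits L hbij hsurj hR (TimesMuSide.ofPassages L hR Ps))) :=
  ⟨LatticeGlue.ofPassages L hbij hsurj hR Ps hG.some⟩

end OfPassages

end Literature.IUT.LogThetaLattice
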